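import Mathlib
import Summits.ValiantsHypothesis.ValiantsHypothesis.Theorems.BarrierLeverDefinableEquationsPartialDerivativeWall
import Summits.ValiantsHypothesis.ValiantsHypothesis.Theorems.BarrierLeverDefinableEquationsFullRankMethodWall
import Summits.ValiantsHypothesis.ValiantsHypothesis.Theorems.BarrierLeverDefinableEquationsProductDepthWall

/-!
# Route BarrierLever — crux `SuccinctHittingSetsForVP` (stmt-14610): `SmallCircuits` IS a
# succinct hitting set for every RANK-THRESHOLD distinguisher class, at every level (val-np-p5 g10)

The D-side crux asks: `∀ a ∃ b n₀ ∀ n ≥ n₀`, the coefficient vectors of `SmallCircuits ℂ n b` hit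
every nonzero member of `Distinguishers ℂ n a` (FSV Question 6; OPEN).  Forbes–Shpilka–Volk prove
succinct hitting sets for distinguisher classes restricted by the COMPUTATIONAL model of `D`
(Thm. 9/10).  The method walls of val-np-p5 g10 (`…PartialDerivativeWall`, `…FullRankMethodWall`,
`…ProductDepthWall`) give the complementary SEMANTIC restriction: distinguishers whose zero set on
degree-`≤ n` coefficient vectors is a RANK THRESHOLD of a classical rank method are hit by ONE
explicit small circuit — uniformly in the level `a` (size and degree of `D` play no role):

* `isSuccinctHittingSet_pdRankThresholds`: `SmallCircuits ℂ n b` (`b ≥ 2`, `n ≥ 3`) hits every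
  nonzero `D` cutting out a partial-derivative rank threshold `{f : rank f_{e,·} < r}`, `e ≤ n/2`
  (the hitting point is the quadric power `(Σ x_i²)^{⌊n/2⌋}`; indeed such a `D` vanishing on the
  class is ZERO);
* `isSuccinctHittingSet_fullRankSound`: `SmallCircuits ℂ (2n) b` (`b ≥ 3`, `n ≥ 2`) hits every `D`
  that is nonzero at all full-rank polynomials — in particular every `D` cutting out the
  non-full-rank locus, as g9's `E_n` (hitting point: the specialised Raz–Yehudayoff polynomial);
* `isSuccinctHittingSet_lstRankThresholds`: `SmallCircuits ℂ n b` (`b ≥ 5`, `n ≥ 4`) hits every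
  nonzero `D` cutting out an LST block-rank threshold `{f : pdRank (killCompl e f) < 2^{min}}`
  for any word datum (hitting point: the placed word polynomial);
* `isSuccinctHittingSet_rankThresholds`: the union of the three classes at once
  (`b ≥ 5`, `2n` variables, `n ≥ 2`).

What this is NOT: not FSV Question 6 (these classes are far from all of `Distinguishers ℂ n a` —
e.g. individual minors of the same matrices are not covered), nothing on `VP ≠ VNP`.
No definitions, no named facts, standard axioms.  Refs: Forbes–Shpilka–Volk, Theory Comput. 14
(2018) Def. 3, Question 6, Thm. 9–10.
-/

-- `Summit.ValiantsHypothesis.ValiantsHypothesis.…` repeats a component by the D-0017 layout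
-- (single-conjunct summit), which the `dupNamespace` linter flags; the name is mandated.
set_option linter.dupNamespace false

noncomputable section

namespace Summit.ValiantsHypothesis.ValiantsHypothesis.Theorems.BarrierLeverDefinableEquations

open MvPolynomial
open Literature.Computability.AlgebraicComplexity hiding IsSyntacticallyMultilinear smCircuitSize
open Literature.Computability.AlgebraicComplexity.LSTWord
open Literature.Barriers.ValiantsHypothesis
open scoped BigOperators

namespace RankThresholdHitting

/-! ## §1 Partial-derivative rank thresholds -/

/-- **`SmallCircuits ℂ n b` hits every nonzero PD-rank-threshold distinguisher** (`b ≥ 2`, `n ≥ 3`):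
if `D ≠ 0` and the zero set of `D` on degree-`≤ n` coefficient vectors is `{rank f_{e,·} < r}`
for some `e ≤ n/2` and `r`, then `D` is nonzero at the coefficient vector of a member of the class.
[cite: ForbesShpilkaVolk2018, Def. 3] -/
theorem isSuccinctHittingSet_pdRankThresholds {n b : ℕ} (hn : 3 ≤ n) (hb : 2 ≤ b) :
    IsSuccinctHittingSet (degLEMonomials n) (SmallCircuits ℂ n b)
      {D | ∃ e r : ℕ, e ≤ n / 2 ∧ ∀ f : MvPolynomial (Fin n) ℂ, f.totalDegree ≤ n →
        (eval (coeffVector (degLEMonomials n) f) D = 0 ↔ shiftedPartialsRank ℂ e 0 f < r)} := by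
  rintro D ⟨e, r, he, hD⟩ hD0
  by_contra h
  simp only [not_exists, not_and, not_not] at h
  exact hD0 (PartialDerivativeWall.distinguisher_eq_zero_of_pdRankSublevel hn hb he D hD h)

/-! ## §2 Full-rank-sound distinguishers (`2n` variables) -/

/-- **`SmallCircuits ℂ (2n) b` hits every distinguisher that is nonzero at all full-rank
polynomials** (`b ≥ 3`, `n ≥ 2`) — the soundness property of any full-rank-method certificate.
[cite: ForbesShpilkaVolk2018, Def. 3] [cite: RazYehudayoff2008, Thm. 4.4] -/
theorem isSuccinctHittingSet_fullRankSound {n b : ℕ} (hn : 2 ≤ n) (hb : 3 ≤ b) :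
    IsSuccinctHittingSet (degLEMonomials (2 * n)) (SmallCircuits ℂ (2 * n) b)
      {D | ∀ g : MvPolynomial (Fin (2 * n)) ℂ, g.totalDegree ≤ 2 * n → IsFullRank n g →
        eval (coeffVector (degLEMonomials (2 * n)) g) D ≠ 0} := by
  intro D hD _
  obtain ⟨g, hg, hfull⟩ := FullRankMethodWall.exists_isFullRank_smallCircuits hn hb
  exact ⟨g, hg, hD g hg.1 hfull⟩

/-- In particular every `D` whose zero set on degree-`≤ 2n` coefficient vectors is exactly the
non-full-rank locus (as g9's full-rank equation) is hit. [cite: ForbesShpilkaVolk2018, Def. 3] -/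
theorem isSuccinctHittingSet_notFullRankLocus {n b : ℕ} (hn : 2 ≤ n) (hb : 3 ≤ b) :
    IsSuccinctHittingSet (degLEMonomials (2 * n)) (SmallCircuits ℂ (2 * n) b)
      {D | ∀ g : MvPolynomial (Fin (2 * n)) ℂ, g.totalDegree ≤ 2 * n →
        (eval (coeffVector (degLEMonomials (2 * n)) g) D = 0 ↔ ¬ IsFullRank n g)} := by
  refine (isSuccinctHittingSet_fullRankSound hn hb).mono le_rfl ?_
  intro D hD g hg hfull h0
  exact (hD g hg).1 h0 hfull

/-! ## §3 LST block-rank thresholds -/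

/-- **`SmallCircuits ℂ n b` hits every nonzero LST-rank-threshold distinguisher** (`b ≥ 5`,
`n ≥ 4`): for any word datum (`1 ≤ d ≤ n`, states fitting into `Fin n`) and embedding `e`, a `D`
whose zero set on degree-`≤ n` coefficient vectors is `{pdRank (killCompl e f) < 2^{min}}` is nonzero
at the placed word polynomial, a member of the class. [cite: ForbesShpilkaVolk2018, Def. 3] [cite: LimayeSrinivasanTavenas2025, §2.2] -/
theorem isSuccinctHittingSet_lstRankThresholds {n b : ℕ} (h4 : 4 ≤ n) (hb : 5 ≤ b) :
    IsSuccinctHittingSet (degLEMonomials n) (SmallCircuits ℂ n b)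
      {D | ∃ (d k : ℕ) (pos : Fin d → Bool) (_ : ∀ t ≤ d, 2 ^ overLen k pos t ≤ n)
          (e : (Σ i : Fin d, BlockVar k pos i) ↪ Fin n), 1 ≤ d ∧ d ≤ n ∧
        ∀ g : MvPolynomial (Fin n) ℂ, g.totalDegree ≤ n →
          (eval (coeffVector (degLEMonomials n) g) D = 0 ↔
            pdRank ℂ (posBlocks pos) (negBlocks pos) (killCompl e.injective g) <
              2 ^ min (streamLen k pos true d) (streamLen k pos false d))} := by
  rintro D ⟨d, k, pos, hn, e, hd, hdn, hD⟩ _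
  obtain ⟨f, hf, hrk⟩ := ProductDepthWall.exists_fullPdRank_smallCircuits k pos h4 hd hdn hn e
  refine ⟨f, smallCircuits_mono ℂ hb (by omega) hf, fun h0 => ?_⟩
  have := (hD f hf.1).1 h0
  rw [hrk] at this
  exact lt_irrefl _ this

/-! ## §4 All three at once -/

/-- **Rank-threshold distinguishers are hit by small circuits, all three kinds at once**: in `2n`
variables, `SmallCircuits ℂ (2n) b` (`b ≥ 5`, `n ≥ 2`) is a succinct hitting set for the union of
the PD-rank-threshold class, the full-rank-sound class and the LST-rank-threshold class — whatever
the size and degree of the distinguisher (every level `a`). [cite: ForbesShpilkaVolk2018, Def. 3 and Question 6] -/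
theorem isSuccinctHittingSet_rankThresholds {n b : ℕ} (hn : 2 ≤ n) (hb : 5 ≤ b) :
    IsSuccinctHittingSet (degLEMonomials (2 * n)) (SmallCircuits ℂ (2 * n) b)
      ({D | ∃ e r : ℕ, e ≤ 2 * n / 2 ∧ ∀ f : MvPolynomial (Fin (2 * n)) ℂ, f.totalDegree ≤ 2 * n →
          (eval (coeffVector (degLEMonomials (2 * n)) f) D = 0 ↔
            shiftedPartialsRank ℂ e 0 f < r)} ∪
       {D | ∀ g : MvPolynomial (Fin (2 * n)) ℂ, g.totalDegree ≤ 2 * n → IsFullRank n g →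
          eval (coeffVector (degLEMonomials (2 * n)) g) D ≠ 0} ∪
       {D | ∃ (d k : ℕ) (pos : Fin d → Bool) (_ : ∀ t ≤ d, 2 ^ overLen k pos t ≤ 2 * n)
            (e : (Σ i : Fin d, BlockVar k pos i) ↪ Fin (2 * n)), 1 ≤ d ∧ d ≤ 2 * n ∧
          ∀ g : MvPolynomial (Fin (2 * n)) ℂ, g.totalDegree ≤ 2 * n →
            (eval (coeffVector (degLEMonomials (2 * n)) g) D = 0 ↔
              pdRank ℂ (posBlocks pos) (negBlocks pos) (killCompl e.injective g) <
                2 ^ min (streamLen k pos true d) (streamLen k pos false d))}) := by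
  intro D hD hD0
  rcases hD with (hD | hD) | hD
  · exact isSuccinctHittingSet_pdRankThresholds (n := 2 * n) (by omega) (by omega) D hD hD0
  · exact isSuccinctHittingSet_fullRankSound hn (by omega) D hD hD0
  · exact isSuccinctHittingSet_lstRankThresholds (n := 2 * n) (by omega) hb D hD hD0

end RankThresholdHitting

end Summit.ValiantsHypothesis.ValiantsHypothesis.Theorems.BarrierLeverDefinableEquations
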